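import Summits.QuantumFields.QCD.Theorems.QuarksAsStableActionCriticalLineDiamagnetismCellFreeSymm

/-!
# The free propagator: colour triviality, constant link amplitude, conjugate backward amplitude (B6 infrastructure, 3/4)

Crux `Summit.QuantumFields.QCD.Theses.QuarksAsStableAction.CriticalLineDiamagnetism` (item stmt-QuantumFields-9734,
sub-problem `Summits/QuantumFields/QCD/Statement.lean`), line `Sketch`, Route B step B6: infrastructure for the registered
cell sub-stub `cellFirstOrder` of `stub_heavyFrequencyGain` (plan `S4-PLAN.md` §B6 of the line lead; vocabulary
`CellFO.*` of `…CellFirstOrderDefs`).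

Consequences of the symmetries for `G = D⁻¹`: `G` is colour-diagonal with equal diagonal blocks, the seam-signed forward
link amplitude `σ₁(x) Σ_{ij} G((x+e₁,0,i),(x,0,j)) (P₋²)_{ji}` is the same on every link (twisted translation covariance),
and the backward amplitude is its complex conjugate (`γ₅`-hermiticity).  Also two small tools for the trace estimate of the
cell lemma (`|Re tr(B P₋)| ≤ 4‖B‖`).
-/

noncomputable section

open scoped BigOperators Matrix ComplexConjugate Kronecker Matrix.Norms.L2Operator
open Matrix Literature.MathematicalPhysics.QuantumLattice
open Summit.QuantumFields.QCD.Cruxes.CriticalLineDiamagnetism.ChessboardCellGain.FrequencyDiamagnetism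
open Summit.QuantumFields.QCD.Cruxes.CriticalLineDiamagnetism.ChessboardCellGain.CellKappa

namespace Summit.QuantumFields.QCD.Cruxes.CriticalLineDiamagnetism.ChessboardCellGain.CellFO

variable {L₁ L₂ : ℕ} [NeZero L₁] [NeZero L₂]

/-! ### Consequences for the free propagator `G = D⁻¹` -/

/-- **Twisted translation covariance of `G` (first coordinate).** -/
theorem free_inv_shift1 {m ω₀ ω₁ : ℝ} (hM : 2 < m + 4 - Real.cos ω₀ - Real.cos ω₁)
    (p q : (ZMod L₁ × ZMod L₂) × Fin 3 × Fin 4) :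
    (freeOp L₁ L₂ m ω₀ ω₁)⁻¹ ((p.1.1 - 1, p.1.2), p.2) ((q.1.1 - 1, q.1.2), q.2) =
      (if p.1.1 = 0 then (-1 : ℂ) else 1) * (if q.1.1 = 0 then (-1 : ℂ) else 1) * (freeOp L₁ L₂ m ω₀ ω₁)⁻¹ p q :=
  inv_covariant (free_isUnit_det hM)
    ⟨fun p => ((p.1.1 - 1, p.1.2), p.2), fun p => ((p.1.1 + 1, p.1.2), p.2), fun p => by simp, fun p => by simp⟩
    (fun p => if p.1.1 = 0 then (-1 : ℂ) else 1) (fun p => sign_mul_self _) (free_shift1 m ω₀ ω₁) p q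

/-- **Twisted translation covariance of `G` (second coordinate).** -/
theorem free_inv_shift2 {m ω₀ ω₁ : ℝ} (hM : 2 < m + 4 - Real.cos ω₀ - Real.cos ω₁)
    (p q : (ZMod L₁ × ZMod L₂) × Fin 3 × Fin 4) :
    (freeOp L₁ L₂ m ω₀ ω₁)⁻¹ ((p.1.1, p.1.2 - 1), p.2) ((q.1.1, q.1.2 - 1), q.2) =
      (if p.1.2 = 0 then (-1 : ℂ) else 1) * (if q.1.2 = 0 then (-1 : ℂ) else 1) * (freeOp L₁ L₂ m ω₀ ω₁)⁻¹ p q :=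
  inv_covariant (free_isUnit_det hM)
    ⟨fun p => ((p.1.1, p.1.2 - 1), p.2), fun p => ((p.1.1, p.1.2 + 1), p.2), fun p => by simp, fun p => by simp⟩
    (fun p => if p.1.2 = 0 then (-1 : ℂ) else 1) (fun p => sign_mul_self _) (free_shift2 m ω₀ ω₁) p q

/-- Colour rotation covariance of `G`. -/
theorem free_inv_colourRot {m ω₀ ω₁ : ℝ} (hM : 2 < m + 4 - Real.cos ω₀ - Real.cos ω₁)
    (p q : (ZMod L₁ × ZMod L₂) × Fin 3 × Fin 4) :
    (freeOp L₁ L₂ m ω₀ ω₁)⁻¹ (p.1, finRotate 3 p.2.1, p.2.2) (q.1, finRotate 3 q.2.1, q.2.2) =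
      (freeOp L₁ L₂ m ω₀ ω₁)⁻¹ p q := by
  have h := inv_covariant (free_isUnit_det hM)
    ⟨fun p => (p.1, finRotate 3 p.2.1, p.2.2), fun p => (p.1, (finRotate 3).symm p.2.1, p.2.2), fun p => by simp,
      fun p => by simp⟩ (fun _ => (1 : ℂ)) (fun _ => one_mul _) (free_colourRot m ω₀ ω₁) p q
  rw [one_mul, one_mul] at h
  exact h

/-- **Colour triviality of `G`**: it is colour-diagonal with equal diagonal blocks. -/
theorem free_inv_colour {m ω₀ ω₁ : ℝ} (hM : 2 < m + 4 - Real.cos ω₀ - Real.cos ω₁)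
    (x y : ZMod L₁ × ZMod L₂) (c c' : Fin 3) (i j : Fin 4) :
    (freeOp L₁ L₂ m ω₀ ω₁)⁻¹ (x, c, i) (y, c', j) =
      if c = c' then (freeOp L₁ L₂ m ω₀ ω₁)⁻¹ (x, 0, i) (y, 0, j) else 0 := by
  by_cases hc : c = c'
  · subst hc
    rw [if_pos rfl]
    have hrot : ∀ c : Fin 3, (freeOp L₁ L₂ m ω₀ ω₁)⁻¹ (x, finRotate 3 c, i) (y, finRotate 3 c, j) =
        (freeOp L₁ L₂ m ω₀ ω₁)⁻¹ (x, c, i) (y, c, j) := fun c => free_inv_colourRot hM (x, c, i) (y, c, j)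
    have h0 := hrot 0
    have h1 := hrot 1
    have e0 : finRotate 3 0 = 1 := by decide
    have e1 : finRotate 3 1 = 2 := by decide
    rw [e0] at h0
    rw [e1] at h1
    fin_cases c
    · rfl
    · exact h0
    · exact h1.trans h0
  · rw [if_neg hc]
    have h := inv_covariant (free_isUnit_det hM) (Equiv.refl _) (fun p => if p.2.1 = c then (1 : ℂ) else -1)
      (fun p => by split_ifs <;> norm_num) (free_colourSign m ω₀ ω₁ c) (x, c, i) (y, c', j)
    simp only [Equiv.refl_apply, if_true, Ne.symm hc, if_false, one_mul, neg_mul, one_mul] at h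
    linear_combination (1 / 2 : ℂ) * h

omit [NeZero L₁] [NeZero L₂] in
/-- `ε_i ε_j (P₋^μ)_{ij} = (P₊^μ)_{ij}` for the chirality signs `ε = (1,1,−1,−1)`. -/
theorem sign_pMinus (μ i j : Fin 4) :
    (![1, 1, -1, -1] : Fin 4 → ℂ) i * (![1, 1, -1, -1] : Fin 4 → ℂ) j * pMinus μ i j = pPlus μ i j := by
  have h := gammaFiveSign_mul_euclideanGamma_mul_gammaFiveSign μ i j
  simp only [pPlus, pMinus, Matrix.smul_apply, Matrix.add_apply, Matrix.sub_apply, Matrix.one_apply, smul_eq_mul]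
  by_cases hij : i = j
  · subst hij
    simp only [if_true]
    linear_combination (-(1 / 2 : ℂ)) * h + (1 / 2 : ℂ) * gammaFiveSign_mul_self i
  · simp only [hij, if_false]
    linear_combination (-(1 / 2 : ℂ)) * h

omit [NeZero L₁] [NeZero L₂] in
/-- `(P₋^μ)ᴴ = P₋^μ` entrywise. -/
theorem star_pMinus (μ i j : Fin 4) : star (pMinus μ j i) = pMinus μ i j := by
  rw [← Matrix.conjTranspose_apply, CellWalk.conjTranspose_pMinus]

omit [NeZero L₁] [NeZero L₂] in
/-- The seam signs along a twisted translation of a forward link cancel. -/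
theorem link_signs (a : ZMod L₁) :
    (if a - 1 = -1 then (-1 : ℂ) else 1) * ((if a + 1 = 0 then (-1 : ℂ) else 1) * (if a = 0 then (-1 : ℂ) else 1)) =
      (if a = -1 then (-1 : ℂ) else 1) := by
  have h2 : (a - 1 = -1) ↔ (a = 0) := by constructor <;> intro h <;> linear_combination h
  have h3 : (a + 1 = 0) ↔ (a = -1) := by constructor <;> intro h <;> linear_combination h
  simp only [h2, h3]
  split_ifs <;> norm_num

/-- **The forward link amplitude is the same on every first-coordinate link**:
`σ₁(x) Σ_{ij} G((x+e₁,0,i),(x,0,j)) (P₋²)_{ji}` does not depend on `x`. -/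
theorem fwdAmp_const {m ω₀ ω₁ : ℝ} (hM : 2 < m + 4 - Real.cos ω₀ - Real.cos ω₁) (x : ZMod L₁ × ZMod L₂) :
    (if x.1 = -1 then (-1 : ℂ) else 1) *
        ∑ i : Fin 4, ∑ j : Fin 4, (freeOp L₁ L₂ m ω₀ ω₁)⁻¹ ((x.1 + 1, x.2), 0, i) (x, 0, j) * pMinus 2 j i =
      (if (0 : ZMod L₁) = -1 then (-1 : ℂ) else 1) *
        ∑ i : Fin 4, ∑ j : Fin 4, (freeOp L₁ L₂ m ω₀ ω₁)⁻¹ (((0 : ZMod L₁) + 1, (0 : ZMod L₂)), 0, i)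
          (((0 : ZMod L₁), (0 : ZMod L₂)), 0, j) * pMinus 2 j i := by
  -- the amplitude as a function of the base point
  set F : ZMod L₁ → ZMod L₂ → ℂ := fun a b => (if a = -1 then (-1 : ℂ) else 1) *
    ∑ i : Fin 4, ∑ j : Fin 4, (freeOp L₁ L₂ m ω₀ ω₁)⁻¹ ((a + 1, b), 0, i) ((a, b), 0, j) * pMinus 2 j i with hF
  have step1 : ∀ a b, F (a - 1) b = F a b := by
    intro a b
    simp only [hF]
    have hG : ∀ i j : Fin 4, (freeOp L₁ L₂ m ω₀ ω₁)⁻¹ ((a - 1 + 1, b), 0, i) ((a - 1, b), 0, j) =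
        (if a + 1 = 0 then (-1 : ℂ) else 1) * (if a = 0 then (-1 : ℂ) else 1) *
          (freeOp L₁ L₂ m ω₀ ω₁)⁻¹ ((a + 1, b), 0, i) ((a, b), 0, j) := by
      intro i j
      have h := free_inv_shift1 hM ((a + 1, b), 0, i) ((a, b), 0, j)
      simp only [add_sub_cancel_right] at h
      rw [sub_add_cancel]
      exact h
    simp only [hG]
    rw [← link_signs a]
    simp only [Finset.mul_sum]
    refine Finset.sum_congr rfl fun i _ => Finset.sum_congr rfl fun j _ => ?_
    ring
  have step2 : ∀ a b, F a (b - 1) = F a b := by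
    intro a b
    simp only [hF]
    have hG : ∀ i j : Fin 4, (freeOp L₁ L₂ m ω₀ ω₁)⁻¹ ((a + 1, b - 1), 0, i) ((a, b - 1), 0, j) =
        (freeOp L₁ L₂ m ω₀ ω₁)⁻¹ ((a + 1, b), 0, i) ((a, b), 0, j) := by
      intro i j
      have h := free_inv_shift2 hM ((a + 1, b), 0, i) ((a, b), 0, j)
      dsimp only at h
      rw [sign_mul_self, one_mul] at h
      exact h
    simp only [hG]
  have hA : ∀ (k : ℕ) (b : ZMod L₂), F (k : ZMod L₁) b = F 0 b := by
    intro k b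
    induction k with
    | zero => rw [Nat.cast_zero]
    | succ k ih => rw [← ih, Nat.cast_succ, ← step1 ((k : ZMod L₁) + 1) b, add_sub_cancel_right]
  have hB : ∀ (k : ℕ), F 0 (k : ZMod L₂) = F 0 0 := by
    intro k
    induction k with
    | zero => rw [Nat.cast_zero]
    | succ k ih => rw [← ih, Nat.cast_succ, ← step2 0 ((k : ZMod L₂) + 1), add_sub_cancel_right]
  obtain ⟨a, b⟩ := x
  obtain ⟨ka, rfl⟩ := ZMod.natCast_zmod_surjective a
  obtain ⟨kb, rfl⟩ := ZMod.natCast_zmod_surjective b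
  change F ka kb = F 0 0
  rw [hA, hB]

/-- **The backward link amplitude is the conjugate of the forward one** (`γ₅`-hermiticity):
`σ₁(x) Σ_{ij} G((x,0,i),(x+e₁,0,j)) (P₊²)_{ji} = conj (σ₁(x) Σ_{ij} G((x+e₁,0,i),(x,0,j)) (P₋²)_{ji})`. -/
theorem bwdAmp_eq_star {m ω₀ ω₁ : ℝ} (hM : 2 < m + 4 - Real.cos ω₀ - Real.cos ω₁) (x : ZMod L₁ × ZMod L₂) :
    (if x.1 = -1 then (-1 : ℂ) else 1) *
        ∑ i : Fin 4, ∑ j : Fin 4, (freeOp L₁ L₂ m ω₀ ω₁)⁻¹ (x, 0, i) ((x.1 + 1, x.2), 0, j) * pPlus 2 j i =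
      star ((if x.1 = -1 then (-1 : ℂ) else 1) *
        ∑ i : Fin 4, ∑ j : Fin 4, (freeOp L₁ L₂ m ω₀ ω₁)⁻¹ ((x.1 + 1, x.2), 0, i) (x, 0, j) * pMinus 2 j i) := by
  rw [star_mul', star_sign, star_sum, Finset.sum_comm]
  congr 1
  refine Finset.sum_congr rfl fun i _ => ?_
  rw [star_sum]
  refine Finset.sum_congr rfl fun j _ => ?_
  rw [star_mul', star_pMinus, free_inv_star hM (x, 0, j) ((x.1 + 1, x.2), 0, i), ← sign_pMinus 2 i j]
  ring


/-! ### Small tools for the trace estimate -/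

omit [NeZero L₁] [NeZero L₂] in
/-- Every entry of a matrix is bounded by its operator norm. -/
theorem norm_entry_le {n : Type} [Fintype n] [DecidableEq n] (A : Matrix n n ℂ) (i j : n) : ‖A i j‖ ≤ ‖A‖ := by
  have h := Matrix.l2_opNorm_mulVec A (EuclideanSpace.single j (1 : ℂ))
  rw [PiLp.norm_single, norm_one, mul_one] at h
  refine le_trans ?_ h
  have hs : (⇑(EuclideanSpace.single j (1 : ℂ)) : n → ℂ) = Pi.single j 1 :=
    funext fun k => by simp [Pi.single_apply, eq_comm]
  have h2 := PiLp.norm_apply_le ((EuclideanSpace.equiv n ℂ).symm (A *ᵥ ⇑(EuclideanSpace.single j (1 : ℂ)))) i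
  have h3 : ((EuclideanSpace.equiv n ℂ).symm (A *ᵥ ⇑(EuclideanSpace.single j (1 : ℂ)))) i = A i j := by
    rw [hs, Matrix.mulVec_single_one]
    rfl
  rw [h3] at h2
  exact h2

omit [NeZero L₁] [NeZero L₂] in
/-- `|Re tr(B P₋^μ)| ≤ 4‖B‖` for a `4 × 4` matrix `B`. -/
theorem abs_re_trace_mul_pMinus_le (B : Matrix (Fin 4) (Fin 4) ℂ) (μ : Fin 4) :
    |((B * pMinus μ).trace).re| ≤ 4 * ‖B‖ := by
  have hent : ∀ i, ‖(B * pMinus μ) i i‖ ≤ ‖B‖ := fun i =>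
    (norm_entry_le _ i i).trans ((Matrix.l2_opNorm_mul _ _).trans
      (mul_le_of_le_one_right (norm_nonneg _) (CellWalk.l2_opNorm_pMinus_le μ)))
  calc |((B * pMinus μ).trace).re| ≤ ‖(B * pMinus μ).trace‖ := Complex.abs_re_le_norm _
    _ ≤ ∑ i, ‖(B * pMinus μ) i i‖ := norm_sum_le _ _
    _ ≤ ∑ _i : Fin 4, ‖B‖ := Finset.sum_le_sum fun i _ => hent i
    _ = 4 * ‖B‖ := by simp

end CellFO

/-- **Registered anchor `cellFreeLinkAmplitude`**: the seam-signed forward link amplitude of the free propagator does not depend on the link (`M_ω > 2`). -/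
theorem cellFreeLinkAmplitude : ∀ (L₁ L₂ : ℕ) [NeZero L₁] [NeZero L₂] (m ω₀ ω₁ : ℝ), 2 < m + 4 - Real.cos ω₀ - Real.cos ω₁ → ∀ (x : ZMod L₁ × ZMod L₂), (if x.1 = -1 then (-1 : ℂ) else 1) * ∑ i : Fin 4, ∑ j : Fin 4, (CellFO.freeOp L₁ L₂ m ω₀ ω₁)⁻¹ ((x.1 + 1, x.2), 0, i) (x, 0, j) * CellKappa.pMinus 2 j i = (if (0 : ZMod L₁) = -1 then (-1 : ℂ) else 1) * ∑ i : Fin 4, ∑ j : Fin 4, (CellFO.freeOp L₁ L₂ m ω₀ ω₁)⁻¹ (((0 : ZMod L₁) + 1, (0 : ZMod L₂)), 0, i) (((0 : ZMod L₁), (0 : ZMod L₂)), 0, j) * CellKappa.pMinus 2 j i :=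
  fun _ _ _ _ _ _ _ hM x => CellFO.fwdAmp_const hM x

end Summit.QuantumFields.QCD.Cruxes.CriticalLineDiamagnetism.ChessboardCellGain

end
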